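import Literature.Topology.FourManifolds.SubmersionStraightening
import Literature.Topology.FourManifolds.SliceChartsCodim
import HarnessLib

/-!
# Regular fibres of smooth maps to `ℝᵇ`, on an open set and at interior points

Topic `Literature/Topology/FourManifolds` (the codimension-`b` regular value theorem at interior
points, on an open subset; the codimension-one, whole-level case is `RegularLevelSet.lean`.
Consumer: fact seat `provefact-Literature.Geometry.Symplectic.Oba2016_s-add47373d4` — the open
fibres `f⁻¹(c) ∩ Int W` of a Lefschetz fibration `f : W⁴ → ℝ²` over the disc as smooth
surfaces without boundary).

**Regular value theorem, vector-valued case, at interior points** (Hirsch, *Differential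
Topology* (1976), Ch. 1 §3, Thm. 3.2: *if `y ∈ f(M)` is a regular value of `f : M → N` then
`f⁻¹(y)` is a submanifold*; Lee, *Introduction to Smooth Manifolds* (2013), Cor. 5.14).  Let
`M` be a `C^∞` manifold modelled on a model with corners `I` on `ℝᴺ`, `a + b = N`,
`f : M → ℝᵇ` smooth, `c ∈ ℝᵇ` and `U ⊆ M` open such that every point of `f⁻¹(c) ∩ U` is an
interior point of `M` at which `df` is onto (`IsRegularFibreOn I hab f c U`; and the technical
condition that some `appendCLE hab (c₀, 0)` is interior to the model, automatic for `𝓡 N` and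
for `𝓡∂ N`, `a ≥ 1`).  Then `f⁻¹(c) ∩ U` is a smooth `a`-manifold without boundary
(`RegularFibreOn h`, instances `ChartedSpace`, `IsManifold (𝓡 a) ∞`, `T2Space`,
`SecondCountableTopology`) whose inclusion into `M` is a smooth embedding
(`RegularFibreOn.isSmoothEmbedding_incl`).  The slice charts are the straightening charts of
`SubmersionStraightening.lean` restricted to `U`; the manifold structure is that of
`SliceChartsCodim.lean`.

## References

* M. W. Hirsch, *Differential Topology*, GTM 33 (1976), Ch. 1 §3, Thms. 3.1–3.2; §4, Thm. 4.1.
  [HirschDT1976]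
* J. M. Lee, *Introduction to Smooth Manifolds*, 2nd ed., GTM 218 (2013), Cor. 5.14.
  [LeeSmoothManifolds2013]
-/

open scoped Manifold ContDiff Topology
open Set Function

noncomputable section

namespace Literature.Topology.FourManifolds

universe u

section RegularFibre

variable {a b N : ℕ} {H : Type*} [TopologicalSpace H]
  (I : ModelWithCorners ℝ (EuclideanSpace ℝ (Fin N)) H) (hab : a + b = N)
  {M : Type u} [TopologicalSpace M] [ChartedSpace H M]

/-- `c` is a *regular value of `f : M → ℝᵇ` on the open set `U`, at interior points*: `U` is
open, `f` is `C^∞`, every point `x ∈ U` with `f x = c` is an interior point of `M` at which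
`df_x` is onto, and (technical, a property of the model alone) some point `appendCLE hab (c₀, 0)`
of the slice `{last b coordinates = 0}` is interior to the model (Hirsch 1976, Ch. 1 §3:
regular point, regular value; here localised to `U` and to the interior).  The fibre may be
empty. [cite: HirschDT1976, Ch. 1 §3–§4] -/
structure IsRegularFibreOn (f : M → EuclideanSpace ℝ (Fin b)) (c : EuclideanSpace ℝ (Fin b))
    (U : Set M) : Prop where
  /-- `U` is open. -/
  isOpen : IsOpen U
  /-- `f` is smooth. -/
  contMDiff : ContMDiff I 𝓘(ℝ, EuclideanSpace ℝ (Fin b)) ∞ f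
  /-- The fibre within `U` lies in the interior of `M`. -/
  isInteriorPoint : ∀ ⦃x⦄, x ∈ U → f x = c → I.IsInteriorPoint x
  /-- `df` is onto along the fibre within `U`. -/
  surjective_mfderiv : ∀ ⦃x⦄, x ∈ U → f x = c →
    Surjective (mfderiv I 𝓘(ℝ, EuclideanSpace ℝ (Fin b)) f x)
  /-- Some point of the slice `{last b coordinates = 0}` is interior to the model. -/
  exists_appendCLE_mem_interior :
    ∃ c₀ : EuclideanSpace ℝ (Fin a), appendCLE hab (c₀, 0) ∈ interior (range I)

variable {I hab}

namespace IsRegularFibreOn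

variable {f : M → EuclideanSpace ℝ (Fin b)} {c : EuclideanSpace ℝ (Fin b)} {U : Set M}

/-- The fibre within `U` is relatively closed: closed in `U`. [folklore] -/
theorem isClosed_inter_preimage (h : IsRegularFibreOn I hab f c U) :
    IsClosed (f ⁻¹' {c}) :=
  isClosed_singleton.preimage h.contMDiff.continuous

/-- The fibre within `U` lies in the interior. [folklore] -/
theorem subset_interior (h : IsRegularFibreOn I hab f c U) : f ⁻¹' {c} ∩ U ⊆ I.interior M :=
  fun _ hx => h.isInteriorPoint hx.2 hx.1

variable [IsManifold I ∞ M]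

/-- Slice charts along a regular fibre within `U`: at every point of `f⁻¹(c) ∩ U` there is a
chart of the maximal atlas with source inside `U`, valued in the interior of the model, in
which `f⁻¹(c) ∩ U` is the slice `{last b coordinates = 0}` (the straightening chart
`exists_straighteningChart`, last coordinates `f - c`, restricted to `U`).
[cite: HirschDT1976, Ch. 1 §3, Thm. 3.2 (proof)] -/
theorem exists_sliceChart (h : IsRegularFibreOn I hab f c U) (p : ↥(f ⁻¹' {c} ∩ U)) :
    ∃ ψ : OpenPartialHomeomorph M H, ψ ∈ IsManifold.maximalAtlas I ∞ M ∧ p.1 ∈ ψ.source ∧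
      (∀ q ∈ ψ.source, q ∈ f ⁻¹' {c} ∩ U ↔ ((appendCLE hab).symm (I (ψ q))).2 = 0) ∧
      ∀ q ∈ ψ.source, I (ψ q) ∈ interior (range I) := by
  obtain ⟨c₀, hc₀⟩ := h.exists_appendCLE_mem_interior
  have hp : f p.1 = c := p.2.1
  obtain ⟨ψ, h1, h2, -, h3, h4⟩ := exists_straighteningChart hab h.contMDiff
    (h.isInteriorPoint p.2.2 hp) (h.surjective_mfderiv p.2.2 hp) c₀ hc₀
  refine ⟨ψ.restr U, restr_mem_maximalAtlas (contDiffGroupoid ∞ I) h1 h.isOpen, ?_, ?_, ?_⟩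
  · rw [ψ.restr_source' U h.isOpen]
    exact ⟨h2, p.2.2⟩
  · intro q hq
    rw [ψ.restr_source' U h.isOpen] at hq
    rw [OpenPartialHomeomorph.restr_apply, h3 q hq.1, sub_eq_zero, hp]
    exact ⟨fun hq' => hq'.1, fun hq' => ⟨hq', hq.2⟩⟩
  · intro q hq
    rw [ψ.restr_source' U h.isOpen] at hq
    rw [OpenPartialHomeomorph.restr_apply]
    exact h4 q hq.1

/-- **The slice charts of a regular fibre** (a choice of one slice chart at each point of
`f⁻¹(c) ∩ U`), the datum from which `SliceChartsCodim.lean` builds the manifold structure.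
[cite: HirschDT1976, Ch. 1 §3, Thm. 3.2] -/
def sliceChartFamily (h : IsRegularFibreOn I hab f c U) :
    SliceChartFamilyCodim I hab (f ⁻¹' {c} ∩ U) where
  chart p := Classical.choose (h.exists_sliceChart p)
  mem_maximalAtlas p := (Classical.choose_spec (h.exists_sliceChart p)).1
  mem_source p := (Classical.choose_spec (h.exists_sliceChart p)).2.1
  mem_iff p := (Classical.choose_spec (h.exists_sliceChart p)).2.2.1
  mem_interior p := (Classical.choose_spec (h.exists_sliceChart p)).2.2.2

end IsRegularFibreOn

/-- **The regular fibre `f⁻¹(c) ∩ U` as a type**: the subtype `↥(f ⁻¹' {c} ∩ U)` of `M`,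
recorded with the proof `h : IsRegularFibreOn I hab f c U` so that the smooth structure built
from `h` can be registered as instances (`ChartedSpace (EuclideanSpace ℝ (Fin a))`,
`IsManifold (𝓡 a) ∞`, `T2Space`, `SecondCountableTopology`).  Hirsch 1976, Ch. 1 §3, Thm. 3.2.
[cite: HirschDT1976, Ch. 1 §3, Thm. 3.2] -/
@[nolint unusedArguments]
def RegularFibreOn {f : M → EuclideanSpace ℝ (Fin b)} {c : EuclideanSpace ℝ (Fin b)} {U : Set M}
    (_h : IsRegularFibreOn I hab f c U) : Type u :=
  ↥(f ⁻¹' {c} ∩ U)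

namespace RegularFibreOn

variable {f : M → EuclideanSpace ℝ (Fin b)} {c : EuclideanSpace ℝ (Fin b)} {U : Set M}

/-- The regular fibre carries the subspace topology. [folklore] -/
instance instTopologicalSpace (h : IsRegularFibreOn I hab f c U) :
    TopologicalSpace (RegularFibreOn h) :=
  instTopologicalSpaceSubtype

/-- The inclusion of the regular fibre into `M` (the subtype coercion). [folklore] -/
@[reducible]
def incl (h : IsRegularFibreOn I hab f c U) : RegularFibreOn h → M := Subtype.val

/-- The points of `RegularFibreOn h` lie on the fibre. [folklore] -/
theorem apply_incl (h : IsRegularFibreOn I hab f c U) (p : RegularFibreOn h) : f (incl h p) = c :=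
  p.2.1

/-- The points of `RegularFibreOn h` lie in `U`. [folklore] -/
theorem incl_mem (h : IsRegularFibreOn I hab f c U) (p : RegularFibreOn h) : incl h p ∈ U :=
  p.2.2

/-- The points of `RegularFibreOn h` are interior points of `M`. [folklore] -/
theorem isInteriorPoint_incl (h : IsRegularFibreOn I hab f c U) (p : RegularFibreOn h) :
    I.IsInteriorPoint (incl h p) :=
  h.isInteriorPoint p.2.2 p.2.1

/-- The image of the inclusion is the fibre `f⁻¹(c) ∩ U`. [folklore] -/
@[simp]
theorem range_incl (h : IsRegularFibreOn I hab f c U) : range (incl h) = f ⁻¹' {c} ∩ U :=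
  Subtype.range_val

/-- The inclusion is a topological embedding. [folklore] -/
theorem isEmbedding_incl (h : IsRegularFibreOn I hab f c U) : Topology.IsEmbedding (incl h) :=
  Topology.IsEmbedding.subtypeVal

/-- A regular fibre in a Hausdorff manifold is Hausdorff. [folklore] -/
instance instT2Space [T2Space M] (h : IsRegularFibreOn I hab f c U) : T2Space (RegularFibreOn h) :=
  inferInstanceAs (T2Space ↥(f ⁻¹' {c} ∩ U))

/-- A regular fibre in a second countable manifold is second countable. [folklore] -/
instance instSecondCountableTopology [SecondCountableTopology M] (h : IsRegularFibreOn I hab f c U) :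
    SecondCountableTopology (RegularFibreOn h) :=
  inferInstanceAs (SecondCountableTopology ↥(f ⁻¹' {c} ∩ U))

/-- `f` is constant (`= c`) on the regular fibre. [folklore] -/
theorem comp_incl (h : IsRegularFibreOn I hab f c U) : f ∘ incl h = fun _ => c :=
  funext fun p => p.2.1

variable [IsManifold I ∞ M]

/-- **The regular fibre is a smooth `a`-manifold, charts**: the atlas of `f⁻¹(c) ∩ U` given by
the slice charts along the fibre with the last `b` coordinates dropped
(`SliceChartFamilyCodim.chartedSpace` of `IsRegularFibreOn.sliceChartFamily`). Hirsch 1976,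
Ch. 1 §3, Thm. 3.2 with §2, p. 14. [cite: HirschDT1976, Ch. 1 §3, Thm. 3.2] -/
instance instChartedSpace (h : IsRegularFibreOn I hab f c U) :
    ChartedSpace (EuclideanSpace ℝ (Fin a)) (RegularFibreOn h) :=
  h.sliceChartFamily.chartedSpace

/-- **The regular fibre is a smooth `a`-manifold, compatibility**: the level charts form a
`C^∞` atlas (`SliceChartFamilyCodim.isManifold`); the model `𝓡 a` is boundaryless. Hirsch 1976,
Ch. 1 §3, Thm. 3.2. [cite: HirschDT1976, Ch. 1 §3, Thm. 3.2] -/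
instance instIsManifold (h : IsRegularFibreOn I hab f c U) :
    IsManifold (𝓡 a) ∞ (RegularFibreOn h) :=
  h.sliceChartFamily.isManifold

/-- The preferred chart of the regular fibre at `p` is the level chart of the chosen slice
chart at `p` (definitional). [folklore] -/
theorem chartAt_eq (h : IsRegularFibreOn I hab f c U) (p : RegularFibreOn h) :
    chartAt (EuclideanSpace ℝ (Fin a)) p = h.sliceChartFamily.levelChart p :=
  rfl

/-- **The inclusion of a regular fibre is a smooth embedding** (Hirsch 1976, Ch. 1 §3,
Thms. 3.1–3.2). [cite: HirschDT1976, Ch. 1 §3, Thms. 3.1–3.2] -/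
theorem isSmoothEmbedding_incl (h : IsRegularFibreOn I hab f c U) :
    Manifold.IsSmoothEmbedding (𝓡 a) I ∞ (incl h) :=
  h.sliceChartFamily.isSmoothEmbedding_subtype_val

/-- The inclusion of a regular fibre is a smooth immersion.
[cite: HirschDT1976, Ch. 1 §3, Thms. 3.1–3.2] -/
theorem isImmersion_incl (h : IsRegularFibreOn I hab f c U) :
    Manifold.IsImmersion (𝓡 a) I ∞ (incl h) :=
  h.sliceChartFamily.isImmersion_subtype_val

/-- The inclusion of a regular fibre is smooth. [cite: HirschDT1976, Ch. 1 §3, Thms. 3.1–3.2] -/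
theorem contMDiff_incl (h : IsRegularFibreOn I hab f c U) : ContMDiff (𝓡 a) I ∞ (incl h) :=
  h.sliceChartFamily.contMDiff_subtype_val

/-- In the preferred chart at `p`, read through the slice chart of `M`, the inclusion is
`u ↦ (chart p)⁻¹ (I⁻¹ (appendCLE hab (u, 0)))` on the chart target. [folklore] -/
theorem incl_chartAt_symm (h : IsRegularFibreOn I hab f c U) (p : RegularFibreOn h)
    {u : EuclideanSpace ℝ (Fin a)} (hu : u ∈ (chartAt (EuclideanSpace ℝ (Fin a)) p).target) :
    incl h ((chartAt (EuclideanSpace ℝ (Fin a)) p).symm u) =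
      (h.sliceChartFamily.chart p).symm (I.symm (appendCLE hab (u, 0))) :=
  h.sliceChartFamily.coe_levelChart_symm_of_mem hu

/-- In the slice chart of `M` at `p`, the points of the fibre have coordinates
`appendCLE hab (chartAt p q, 0)`. [folklore] -/
theorem appendCLE_chartAt (h : IsRegularFibreOn I hab f c U) (p : RegularFibreOn h)
    {q : RegularFibreOn h} (hq : q ∈ (chartAt (EuclideanSpace ℝ (Fin a)) p).source) :
    appendCLE hab (chartAt (EuclideanSpace ℝ (Fin a)) p q, 0) =
      I (h.sliceChartFamily.chart p (incl h q)) :=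
  h.sliceChartFamily.appendCLE_levelChart hq

end RegularFibreOn

/-- **Regular value theorem (vector-valued, interior, on an open set), existential form.** Under
`IsRegularFibreOn I hab f c U` on a Hausdorff second countable `C^∞` manifold `M`, there is a
smooth `a`-manifold `L` without boundary (Hausdorff, second countable) and a smooth embedding
`e : L → M` with image exactly `f⁻¹(c) ∩ U` — namely `L = RegularFibreOn h`, `e = incl`.
Hirsch 1976, Ch. 1 §3, Thms. 3.1–3.2. [cite: HirschDT1976, Ch. 1 §3, Thms. 3.1–3.2] -/
theorem IsRegularFibreOn.exists_isSmoothEmbedding_range_eq [T2Space M] [SecondCountableTopology M]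
    [IsManifold I ∞ M] {f : M → EuclideanSpace ℝ (Fin b)} {c : EuclideanSpace ℝ (Fin b)}
    {U : Set M} (h : IsRegularFibreOn I hab f c U) :
    ∃ (L : Type u) (_ : TopologicalSpace L) (_ : T2Space L) (_ : SecondCountableTopology L)
      (_ : ChartedSpace (EuclideanSpace ℝ (Fin a)) L) (_ : IsManifold (𝓡 a) ∞ L) (e : L → M),
      Manifold.IsSmoothEmbedding (𝓡 a) I ∞ e ∧ range e = f ⁻¹' {c} ∩ U :=
  ⟨RegularFibreOn h, inferInstance, inferInstance, inferInstance, inferInstance, inferInstance,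
    RegularFibreOn.incl h, RegularFibreOn.isSmoothEmbedding_incl h, RegularFibreOn.range_incl h⟩

end RegularFibre

end Literature.Topology.FourManifolds

end
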